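import Summits.Ventures.PercRepro.RankLevelSetLevelSixHeavyCell
import Summits.Ventures.PercRepro.RankLevelSetDepCountHeavySq
import Summits.Ventures.PercRepro.RankLevelSetLevelSix
import Summits.Ventures.PercRepro.S1FourCircuitCount
import Summits.Ventures.PercRepro.RankLevelSetPlaneSix
import Summits.Ventures.PercRepro.S1TriangleCount
import Summits.Ventures.PercRepro.RankLevelSetTriangleStar
import Summits.Ventures.PercRepro.RankLevelSetCorankFiveCounts
import Summits.Ventures.PercRepro.RankLevelSetPlaneTen
import Summits.Ventures.PercRepro.RankLevelSetPlaneTenPrime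
import Summits.Ventures.PercRepro.S1TrianglePlusPlus
import Summits.Ventures.PercRepro.RankLevelSetCoreFour
import Summits.Ventures.PercRepro.RankLevelSetFrameLarge
import Summits.Ventures.PercRepro.RankLevelSetFrameQM
import Summits.Ventures.PercRepro.RankLevelSetLevelFiveAll
import Summits.Ventures.PercRepro.RankLevelSetLevelSixGiant
import Summits.Ventures.PercRepro.RankLevelSetCoreSixLowSelfDA

/-!
# PercRepro — THE REGIME-II CELLS `(34, 52 … 54)`, `(35, 52 … 53)`, `(36, 52)` AND THE CORANK-`≥ 52` CELLS OF RANKS `33 … 36` (p8 g4, S3; part B)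

`proofs/SUBCLAIM-S3-p8.md` §3p. The corank regime of the level-`6` row at ranks `33 … 36`, SELF-CONTAINED over tree
modules with oleans (RankLevelSetCoreSixLowSelf's device from `n₀ ≥ 89`, `core_six_corank_of_key_sub'`): at `p = 33, 34,
35, 36` the subtracted-term key `(2^{p+6} + 7700·C(p+6, p))·2^{33}·C(n, 6) ≤ C(p+6, p)·C(n, p − 1)` holds from `n₀ = 89`
(`key_six_sub_p_89'`, decided: slack `1.76 / 1.82 / 1.78 / 1.64`), so the cells `(p, d)` with `p + d ≥ 89` close by the
device; the cells between the counting route (`d ≤ 51`) and `n = 89` — `(33, 52 … 55)`, `(34, 52 … 54)`, `(35, 52 … 53)`,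
`(36, 52)` — close by REGIME II WITH THE HEAVY-FREE COUNT (`c025_core_six_cell_regII_top'`, the cell theorem of
RankLevelSetCoreSixLowSelfC restated here over LowSelf so that this module needs no un-built parent: `Y ≥ C(n, p − 1) −
#{r ≤ 6}`, `#{r ≤ 6} ≤ (Σ_{j ≤ 6} C(n, j))·2^{33}`, `U ≤ C(n, 6) + (σ₁² + σ₂²)·P(n)` at `ν₁ = 34` with LEMMA T⁺⁺ and T4 —
tree facts only; ratios `0.269 / 0.188 / 0.132 / 0.094`, `0.180 / 0.125 / 0.087`, `0.123 / 0.084`, `0.086`). Part B (on part A's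
`c025_core_six_cell_regII_top'` and `c025_core_six_thirtythree_corank`): the six cells of ranks `34 … 36`, the keys at `p = 34, 35, 36`, and
**`c025_core_six_thirtynine_thirtythree' (33 ≤ p) (p + 51 < |E|)`** (`p ≥ 37` by LowSelf's `c025_core_six_thirtynine_thirtyseven'`).
Axioms: standard.
-/

open scoped Matroid

namespace PercRepro

namespace ThmN

open Set

variable {α : Type}

/-- The numeral of the cell `(34, 52)`: `2^{40}/C(40, 6)·U(86) + A(86) ≤ C(86, 33)`. -/
theorem cell_34_52_numeral' :
    ((2 : ℚ) ^ (34 + 6) / (((34 + 6).choose 6 : ℕ) : ℚ)) * ((((34 + 52).choose 6 : ℕ) : ℚ) +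
      ((∑ i ∈ Finset.range (52 - 7 + 1), ((Nat.choose (min (min 19 (5 + 52) - 6) (34 - 2)) i : ℕ) : ℚ) / (((i : ℚ) + 1) ^ 2)) *
        ((((52 * 52 + 8 - 3 * 52) / 2 : ℕ) : ℚ) * ((34 + 52).choose 4 : ℚ) + ((52 * (52 + 1) * (52 + 2) / 3 : ℕ) : ℚ) * ((34 + 52).choose 3 : ℚ) +
          (((52 + 4).choose 5 : ℕ) : ℚ) * ((34 + 52).choose 2 : ℚ) + (((52 + 5).choose 6 : ℕ) : ℚ) * ((34 + 52 : ℕ) : ℚ) +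
          (((52 + 6).choose 7 : ℕ) : ℚ)) +
      (∑ i ∈ Finset.range (52 - 7 + 1), ((Nat.choose (34 - 2) i : ℕ) : ℚ) / (((i : ℚ) + 1) ^ 2)) *
        ((((52 * 52 + 8 - 3 * 52) / 2 : ℕ) : ℚ) * ((34 + 52).choose 4 : ℚ) + ((52 * (52 + 1) * (52 + 2) / 3 : ℕ) : ℚ) * ((34 + 52).choose 3 : ℚ) +
          (((52 + 4).choose 5 : ℕ) : ℚ) * ((34 + 52).choose 2 : ℚ) + (((52 + 5).choose 6 : ℕ) : ℚ) * ((34 + 52 : ℕ) : ℚ) +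
          (((52 + 6).choose 7 : ℕ) : ℚ)))) +
      (((∑ j ∈ Finset.range (6 + 1), (34 + 52).choose j) : ℕ) : ℚ) * 2 ^ 33 ≤ (((34 + 52).choose (34 - 1) : ℕ) : ℚ) := by
  have hσ1 : (∑ i ∈ Finset.range (52 - 7 + 1), ((Nat.choose (min (min 19 (5 + 52) - 6) (34 - 2)) i : ℕ) : ℚ) / (((i : ℚ) + 1) ^ 2)) =
      (∑ i ∈ Finset.range (52 - 7 + 1), ((Nat.choose 13 i : ℕ) : ℚ) / (((i : ℚ) + 1) ^ 2)) := by
    norm_num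
  have hσ2 : (∑ i ∈ Finset.range (52 - 7 + 1), ((Nat.choose (34 - 2) i : ℕ) : ℚ) / (((i : ℚ) + 1) ^ 2)) =
      (∑ i ∈ Finset.range (52 - 7 + 1), ((Nat.choose 32 i : ℕ) : ℚ) / (((i : ℚ) + 1) ^ 2)) := by
    norm_num
  rw [hσ1, hσ2]
  simp only [Finset.sum_range_succ, Finset.sum_range_zero]
  norm_num [Nat.choose]

/-- **The cell `(34, 52)`.** -/
theorem c025_core_six_cell_34_52' (M : Matroid α) [M.Finite] (hR : M.eRank = (34 : ℕ∞)) (hn : M.E.ncard = 34 + 52)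
    (hfree : ∀ e ∈ M.E, ∃ A ⊆ M.E \ {e}, e ∉ M.closure A ∧ e ∉ M.closure ((M.E \ {e}) \ A)) : RLS M 34 6 :=
  c025_core_six_cell_regII_top' M 34 52 (by norm_num) (by norm_num) hR hn hfree cell_34_52_numeral'

/-- The numeral of the cell `(34, 53)`: `2^{40}/C(40, 6)·U(87) + A(87) ≤ C(87, 33)`. -/
theorem cell_34_53_numeral' :
    ((2 : ℚ) ^ (34 + 6) / (((34 + 6).choose 6 : ℕ) : ℚ)) * ((((34 + 53).choose 6 : ℕ) : ℚ) +
      ((∑ i ∈ Finset.range (53 - 7 + 1), ((Nat.choose (min (min 19 (5 + 53) - 6) (34 - 2)) i : ℕ) : ℚ) / (((i : ℚ) + 1) ^ 2)) *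
        ((((53 * 53 + 8 - 3 * 53) / 2 : ℕ) : ℚ) * ((34 + 53).choose 4 : ℚ) + ((53 * (53 + 1) * (53 + 2) / 3 : ℕ) : ℚ) * ((34 + 53).choose 3 : ℚ) +
          (((53 + 4).choose 5 : ℕ) : ℚ) * ((34 + 53).choose 2 : ℚ) + (((53 + 5).choose 6 : ℕ) : ℚ) * ((34 + 53 : ℕ) : ℚ) +
          (((53 + 6).choose 7 : ℕ) : ℚ)) +
      (∑ i ∈ Finset.range (53 - 7 + 1), ((Nat.choose (34 - 2) i : ℕ) : ℚ) / (((i : ℚ) + 1) ^ 2)) *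
        ((((53 * 53 + 8 - 3 * 53) / 2 : ℕ) : ℚ) * ((34 + 53).choose 4 : ℚ) + ((53 * (53 + 1) * (53 + 2) / 3 : ℕ) : ℚ) * ((34 + 53).choose 3 : ℚ) +
          (((53 + 4).choose 5 : ℕ) : ℚ) * ((34 + 53).choose 2 : ℚ) + (((53 + 5).choose 6 : ℕ) : ℚ) * ((34 + 53 : ℕ) : ℚ) +
          (((53 + 6).choose 7 : ℕ) : ℚ)))) +
      (((∑ j ∈ Finset.range (6 + 1), (34 + 53).choose j) : ℕ) : ℚ) * 2 ^ 33 ≤ (((34 + 53).choose (34 - 1) : ℕ) : ℚ) := by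
  have hσ1 : (∑ i ∈ Finset.range (53 - 7 + 1), ((Nat.choose (min (min 19 (5 + 53) - 6) (34 - 2)) i : ℕ) : ℚ) / (((i : ℚ) + 1) ^ 2)) =
      (∑ i ∈ Finset.range (53 - 7 + 1), ((Nat.choose 13 i : ℕ) : ℚ) / (((i : ℚ) + 1) ^ 2)) := by
    norm_num
  have hσ2 : (∑ i ∈ Finset.range (53 - 7 + 1), ((Nat.choose (34 - 2) i : ℕ) : ℚ) / (((i : ℚ) + 1) ^ 2)) =
      (∑ i ∈ Finset.range (53 - 7 + 1), ((Nat.choose 32 i : ℕ) : ℚ) / (((i : ℚ) + 1) ^ 2)) := by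
    norm_num
  rw [hσ1, hσ2]
  simp only [Finset.sum_range_succ, Finset.sum_range_zero]
  norm_num [Nat.choose]

/-- **The cell `(34, 53)`.** -/
theorem c025_core_six_cell_34_53' (M : Matroid α) [M.Finite] (hR : M.eRank = (34 : ℕ∞)) (hn : M.E.ncard = 34 + 53)
    (hfree : ∀ e ∈ M.E, ∃ A ⊆ M.E \ {e}, e ∉ M.closure A ∧ e ∉ M.closure ((M.E \ {e}) \ A)) : RLS M 34 6 :=
  c025_core_six_cell_regII_top' M 34 53 (by norm_num) (by norm_num) hR hn hfree cell_34_53_numeral'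

/-- The numeral of the cell `(34, 54)`: `2^{40}/C(40, 6)·U(88) + A(88) ≤ C(88, 33)`. -/
theorem cell_34_54_numeral' :
    ((2 : ℚ) ^ (34 + 6) / (((34 + 6).choose 6 : ℕ) : ℚ)) * ((((34 + 54).choose 6 : ℕ) : ℚ) +
      ((∑ i ∈ Finset.range (54 - 7 + 1), ((Nat.choose (min (min 19 (5 + 54) - 6) (34 - 2)) i : ℕ) : ℚ) / (((i : ℚ) + 1) ^ 2)) *
        ((((54 * 54 + 8 - 3 * 54) / 2 : ℕ) : ℚ) * ((34 + 54).choose 4 : ℚ) + ((54 * (54 + 1) * (54 + 2) / 3 : ℕ) : ℚ) * ((34 + 54).choose 3 : ℚ) +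
          (((54 + 4).choose 5 : ℕ) : ℚ) * ((34 + 54).choose 2 : ℚ) + (((54 + 5).choose 6 : ℕ) : ℚ) * ((34 + 54 : ℕ) : ℚ) +
          (((54 + 6).choose 7 : ℕ) : ℚ)) +
      (∑ i ∈ Finset.range (54 - 7 + 1), ((Nat.choose (34 - 2) i : ℕ) : ℚ) / (((i : ℚ) + 1) ^ 2)) *
        ((((54 * 54 + 8 - 3 * 54) / 2 : ℕ) : ℚ) * ((34 + 54).choose 4 : ℚ) + ((54 * (54 + 1) * (54 + 2) / 3 : ℕ) : ℚ) * ((34 + 54).choose 3 : ℚ) +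
          (((54 + 4).choose 5 : ℕ) : ℚ) * ((34 + 54).choose 2 : ℚ) + (((54 + 5).choose 6 : ℕ) : ℚ) * ((34 + 54 : ℕ) : ℚ) +
          (((54 + 6).choose 7 : ℕ) : ℚ)))) +
      (((∑ j ∈ Finset.range (6 + 1), (34 + 54).choose j) : ℕ) : ℚ) * 2 ^ 33 ≤ (((34 + 54).choose (34 - 1) : ℕ) : ℚ) := by
  have hσ1 : (∑ i ∈ Finset.range (54 - 7 + 1), ((Nat.choose (min (min 19 (5 + 54) - 6) (34 - 2)) i : ℕ) : ℚ) / (((i : ℚ) + 1) ^ 2)) =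
      (∑ i ∈ Finset.range (54 - 7 + 1), ((Nat.choose 13 i : ℕ) : ℚ) / (((i : ℚ) + 1) ^ 2)) := by
    norm_num
  have hσ2 : (∑ i ∈ Finset.range (54 - 7 + 1), ((Nat.choose (34 - 2) i : ℕ) : ℚ) / (((i : ℚ) + 1) ^ 2)) =
      (∑ i ∈ Finset.range (54 - 7 + 1), ((Nat.choose 32 i : ℕ) : ℚ) / (((i : ℚ) + 1) ^ 2)) := by
    norm_num
  rw [hσ1, hσ2]
  simp only [Finset.sum_range_succ, Finset.sum_range_zero]
  norm_num [Nat.choose]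

/-- **The cell `(34, 54)`.** -/
theorem c025_core_six_cell_34_54' (M : Matroid α) [M.Finite] (hR : M.eRank = (34 : ℕ∞)) (hn : M.E.ncard = 34 + 54)
    (hfree : ∀ e ∈ M.E, ∃ A ⊆ M.E \ {e}, e ∉ M.closure A ∧ e ∉ M.closure ((M.E \ {e}) \ A)) : RLS M 34 6 :=
  c025_core_six_cell_regII_top' M 34 54 (by norm_num) (by norm_num) hR hn hfree cell_34_54_numeral'

/-- The numeral of the cell `(35, 52)`: `2^{41}/C(41, 6)·U(87) + A(87) ≤ C(87, 34)`. -/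
theorem cell_35_52_numeral' :
    ((2 : ℚ) ^ (35 + 6) / (((35 + 6).choose 6 : ℕ) : ℚ)) * ((((35 + 52).choose 6 : ℕ) : ℚ) +
      ((∑ i ∈ Finset.range (52 - 7 + 1), ((Nat.choose (min (min 19 (5 + 52) - 6) (34 - 2)) i : ℕ) : ℚ) / (((i : ℚ) + 1) ^ 2)) *
        ((((52 * 52 + 8 - 3 * 52) / 2 : ℕ) : ℚ) * ((35 + 52).choose 4 : ℚ) + ((52 * (52 + 1) * (52 + 2) / 3 : ℕ) : ℚ) * ((35 + 52).choose 3 : ℚ) +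
          (((52 + 4).choose 5 : ℕ) : ℚ) * ((35 + 52).choose 2 : ℚ) + (((52 + 5).choose 6 : ℕ) : ℚ) * ((35 + 52 : ℕ) : ℚ) +
          (((52 + 6).choose 7 : ℕ) : ℚ)) +
      (∑ i ∈ Finset.range (52 - 7 + 1), ((Nat.choose (34 - 2) i : ℕ) : ℚ) / (((i : ℚ) + 1) ^ 2)) *
        ((((52 * 52 + 8 - 3 * 52) / 2 : ℕ) : ℚ) * ((35 + 52).choose 4 : ℚ) + ((52 * (52 + 1) * (52 + 2) / 3 : ℕ) : ℚ) * ((35 + 52).choose 3 : ℚ) +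
          (((52 + 4).choose 5 : ℕ) : ℚ) * ((35 + 52).choose 2 : ℚ) + (((52 + 5).choose 6 : ℕ) : ℚ) * ((35 + 52 : ℕ) : ℚ) +
          (((52 + 6).choose 7 : ℕ) : ℚ)))) +
      (((∑ j ∈ Finset.range (6 + 1), (35 + 52).choose j) : ℕ) : ℚ) * 2 ^ 33 ≤ (((35 + 52).choose (35 - 1) : ℕ) : ℚ) := by
  have hσ1 : (∑ i ∈ Finset.range (52 - 7 + 1), ((Nat.choose (min (min 19 (5 + 52) - 6) (34 - 2)) i : ℕ) : ℚ) / (((i : ℚ) + 1) ^ 2)) =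
      (∑ i ∈ Finset.range (52 - 7 + 1), ((Nat.choose 13 i : ℕ) : ℚ) / (((i : ℚ) + 1) ^ 2)) := by
    norm_num
  have hσ2 : (∑ i ∈ Finset.range (52 - 7 + 1), ((Nat.choose (34 - 2) i : ℕ) : ℚ) / (((i : ℚ) + 1) ^ 2)) =
      (∑ i ∈ Finset.range (52 - 7 + 1), ((Nat.choose 32 i : ℕ) : ℚ) / (((i : ℚ) + 1) ^ 2)) := by
    norm_num
  rw [hσ1, hσ2]
  simp only [Finset.sum_range_succ, Finset.sum_range_zero]
  norm_num [Nat.choose]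

/-- **The cell `(35, 52)`.** -/
theorem c025_core_six_cell_35_52' (M : Matroid α) [M.Finite] (hR : M.eRank = (35 : ℕ∞)) (hn : M.E.ncard = 35 + 52)
    (hfree : ∀ e ∈ M.E, ∃ A ⊆ M.E \ {e}, e ∉ M.closure A ∧ e ∉ M.closure ((M.E \ {e}) \ A)) : RLS M 35 6 :=
  c025_core_six_cell_regII_top' M 35 52 (by norm_num) (by norm_num) hR hn hfree cell_35_52_numeral'

/-- The numeral of the cell `(35, 53)`: `2^{41}/C(41, 6)·U(88) + A(88) ≤ C(88, 34)`. -/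
theorem cell_35_53_numeral' :
    ((2 : ℚ) ^ (35 + 6) / (((35 + 6).choose 6 : ℕ) : ℚ)) * ((((35 + 53).choose 6 : ℕ) : ℚ) +
      ((∑ i ∈ Finset.range (53 - 7 + 1), ((Nat.choose (min (min 19 (5 + 53) - 6) (34 - 2)) i : ℕ) : ℚ) / (((i : ℚ) + 1) ^ 2)) *
        ((((53 * 53 + 8 - 3 * 53) / 2 : ℕ) : ℚ) * ((35 + 53).choose 4 : ℚ) + ((53 * (53 + 1) * (53 + 2) / 3 : ℕ) : ℚ) * ((35 + 53).choose 3 : ℚ) +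
          (((53 + 4).choose 5 : ℕ) : ℚ) * ((35 + 53).choose 2 : ℚ) + (((53 + 5).choose 6 : ℕ) : ℚ) * ((35 + 53 : ℕ) : ℚ) +
          (((53 + 6).choose 7 : ℕ) : ℚ)) +
      (∑ i ∈ Finset.range (53 - 7 + 1), ((Nat.choose (34 - 2) i : ℕ) : ℚ) / (((i : ℚ) + 1) ^ 2)) *
        ((((53 * 53 + 8 - 3 * 53) / 2 : ℕ) : ℚ) * ((35 + 53).choose 4 : ℚ) + ((53 * (53 + 1) * (53 + 2) / 3 : ℕ) : ℚ) * ((35 + 53).choose 3 : ℚ) +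
          (((53 + 4).choose 5 : ℕ) : ℚ) * ((35 + 53).choose 2 : ℚ) + (((53 + 5).choose 6 : ℕ) : ℚ) * ((35 + 53 : ℕ) : ℚ) +
          (((53 + 6).choose 7 : ℕ) : ℚ)))) +
      (((∑ j ∈ Finset.range (6 + 1), (35 + 53).choose j) : ℕ) : ℚ) * 2 ^ 33 ≤ (((35 + 53).choose (35 - 1) : ℕ) : ℚ) := by
  have hσ1 : (∑ i ∈ Finset.range (53 - 7 + 1), ((Nat.choose (min (min 19 (5 + 53) - 6) (34 - 2)) i : ℕ) : ℚ) / (((i : ℚ) + 1) ^ 2)) =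
      (∑ i ∈ Finset.range (53 - 7 + 1), ((Nat.choose 13 i : ℕ) : ℚ) / (((i : ℚ) + 1) ^ 2)) := by
    norm_num
  have hσ2 : (∑ i ∈ Finset.range (53 - 7 + 1), ((Nat.choose (34 - 2) i : ℕ) : ℚ) / (((i : ℚ) + 1) ^ 2)) =
      (∑ i ∈ Finset.range (53 - 7 + 1), ((Nat.choose 32 i : ℕ) : ℚ) / (((i : ℚ) + 1) ^ 2)) := by
    norm_num
  rw [hσ1, hσ2]
  simp only [Finset.sum_range_succ, Finset.sum_range_zero]
  norm_num [Nat.choose]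

/-- **The cell `(35, 53)`.** -/
theorem c025_core_six_cell_35_53' (M : Matroid α) [M.Finite] (hR : M.eRank = (35 : ℕ∞)) (hn : M.E.ncard = 35 + 53)
    (hfree : ∀ e ∈ M.E, ∃ A ⊆ M.E \ {e}, e ∉ M.closure A ∧ e ∉ M.closure ((M.E \ {e}) \ A)) : RLS M 35 6 :=
  c025_core_six_cell_regII_top' M 35 53 (by norm_num) (by norm_num) hR hn hfree cell_35_53_numeral'

/-- The numeral of the cell `(36, 52)`: `2^{42}/C(42, 6)·U(88) + A(88) ≤ C(88, 35)`. -/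
theorem cell_36_52_numeral' :
    ((2 : ℚ) ^ (36 + 6) / (((36 + 6).choose 6 : ℕ) : ℚ)) * ((((36 + 52).choose 6 : ℕ) : ℚ) +
      ((∑ i ∈ Finset.range (52 - 7 + 1), ((Nat.choose (min (min 19 (5 + 52) - 6) (34 - 2)) i : ℕ) : ℚ) / (((i : ℚ) + 1) ^ 2)) *
        ((((52 * 52 + 8 - 3 * 52) / 2 : ℕ) : ℚ) * ((36 + 52).choose 4 : ℚ) + ((52 * (52 + 1) * (52 + 2) / 3 : ℕ) : ℚ) * ((36 + 52).choose 3 : ℚ) +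
          (((52 + 4).choose 5 : ℕ) : ℚ) * ((36 + 52).choose 2 : ℚ) + (((52 + 5).choose 6 : ℕ) : ℚ) * ((36 + 52 : ℕ) : ℚ) +
          (((52 + 6).choose 7 : ℕ) : ℚ)) +
      (∑ i ∈ Finset.range (52 - 7 + 1), ((Nat.choose (34 - 2) i : ℕ) : ℚ) / (((i : ℚ) + 1) ^ 2)) *
        ((((52 * 52 + 8 - 3 * 52) / 2 : ℕ) : ℚ) * ((36 + 52).choose 4 : ℚ) + ((52 * (52 + 1) * (52 + 2) / 3 : ℕ) : ℚ) * ((36 + 52).choose 3 : ℚ) +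
          (((52 + 4).choose 5 : ℕ) : ℚ) * ((36 + 52).choose 2 : ℚ) + (((52 + 5).choose 6 : ℕ) : ℚ) * ((36 + 52 : ℕ) : ℚ) +
          (((52 + 6).choose 7 : ℕ) : ℚ)))) +
      (((∑ j ∈ Finset.range (6 + 1), (36 + 52).choose j) : ℕ) : ℚ) * 2 ^ 33 ≤ (((36 + 52).choose (36 - 1) : ℕ) : ℚ) := by
  have hσ1 : (∑ i ∈ Finset.range (52 - 7 + 1), ((Nat.choose (min (min 19 (5 + 52) - 6) (34 - 2)) i : ℕ) : ℚ) / (((i : ℚ) + 1) ^ 2)) =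
      (∑ i ∈ Finset.range (52 - 7 + 1), ((Nat.choose 13 i : ℕ) : ℚ) / (((i : ℚ) + 1) ^ 2)) := by
    norm_num
  have hσ2 : (∑ i ∈ Finset.range (52 - 7 + 1), ((Nat.choose (34 - 2) i : ℕ) : ℚ) / (((i : ℚ) + 1) ^ 2)) =
      (∑ i ∈ Finset.range (52 - 7 + 1), ((Nat.choose 32 i : ℕ) : ℚ) / (((i : ℚ) + 1) ^ 2)) := by
    norm_num
  rw [hσ1, hσ2]
  simp only [Finset.sum_range_succ, Finset.sum_range_zero]
  norm_num [Nat.choose]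

/-- **The cell `(36, 52)`.** -/
theorem c025_core_six_cell_36_52' (M : Matroid α) [M.Finite] (hR : M.eRank = (36 : ℕ∞)) (hn : M.E.ncard = 36 + 52)
    (hfree : ∀ e ∈ M.E, ∃ A ⊆ M.E \ {e}, e ∉ M.closure A ∧ e ∉ M.closure ((M.E \ {e}) \ A)) : RLS M 36 6 :=
  c025_core_six_cell_regII_top' M 36 52 (by norm_num) (by norm_num) hR hn hfree cell_36_52_numeral'

/-- The key with the subtracted term at `p = 34`, `n = 89` — one numeral, decided. -/
theorem key_six_sub_34_89' :
    (2 ^ 40 + 7700 * Nat.choose 40 34) * 2 ^ 33 * Nat.choose 89 6 ≤ Nat.choose 40 34 * Nat.choose 89 33 := by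
  decide

/-- The key with the subtracted term at `p = 35`, `n = 89` — one numeral, decided. -/
theorem key_six_sub_35_89' :
    (2 ^ 41 + 7700 * Nat.choose 41 35) * 2 ^ 33 * Nat.choose 89 6 ≤ Nat.choose 41 35 * Nat.choose 89 34 := by
  decide

/-- The key with the subtracted term at `p = 36`, `n = 89` — one numeral, decided. -/
theorem key_six_sub_36_89' :
    (2 ^ 42 + 7700 * Nat.choose 42 36) * 2 ^ 33 * Nat.choose 89 6 ≤ Nat.choose 42 36 * Nat.choose 89 35 := by
  decide

/-- **The `e`-free core at level `6`, every corank `≥ 52`, every rank `p ≥ 33`** (`p ≥ 37`: LowSelf; `33 ≤ p ≤ 36`: the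
regime-II cells up to `n = 88` and the key decided at `n₀ = 89`). -/
theorem c025_core_six_thirtynine_thirtythree' (M : Matroid α) [M.Finite] (p : ℕ) (hp : 33 ≤ p)
    (hR : M.eRank = (p : ℕ∞)) (hbig : p + 51 < M.E.ncard)
    (hfree : ∀ e ∈ M.E, ∃ A ⊆ M.E \ {e}, e ∉ M.closure A ∧ e ∉ M.closure ((M.E \ {e}) \ A)) : RLS M p 6 := by
  rcases Nat.lt_or_ge p 37 with hlt | hge
  swap
  · exact c025_core_six_thirtynine_thirtyseven' M p hge hR hbig hfree
  rcases Nat.lt_or_ge M.E.ncard 89 with hsmall | hbig89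
  · -- the finitely many cells between the counting route and `n = 89`
    interval_cases p
    · exact c025_core_six_thirtythree_corank M hR hbig hfree
    · rcases Nat.lt_or_ge M.E.ncard 87 with h | h
      · exact c025_core_six_cell_34_52' M hR (by omega) hfree
      rcases Nat.lt_or_ge M.E.ncard 88 with h' | h'
      · exact c025_core_six_cell_34_53' M hR (by omega) hfree
      · exact c025_core_six_cell_34_54' M hR (by omega) hfree
    · rcases Nat.lt_or_ge M.E.ncard 88 with h | h
      · exact c025_core_six_cell_35_52' M hR (by omega) hfree
      · exact c025_core_six_cell_35_53' M hR (by omega) hfree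
    · exact c025_core_six_cell_36_52' M hR (by omega) hfree
  · -- `n ≥ 89`: the key
    interval_cases p
    · exact c025_core_six_thirtythree_corank M hR hbig hfree
    · refine core_six_corank_of_key_sub' 89 le_rfl M 34 (by norm_num) ?_ (by omega) hfree
      have hk := key_of_base' 34 6 ((2 ^ 40 + 7700 * Nat.choose 40 34) * 2 ^ 33) (Nat.choose 40 34) 89
        (by norm_num) (by norm_num) (by norm_num) key_six_sub_34_89'
      intro n hn
      have := hk n hn
      simpa using this
    · refine core_six_corank_of_key_sub' 89 le_rfl M 35 (by norm_num) ?_ (by omega) hfree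
      have hk := key_of_base' 35 6 ((2 ^ 41 + 7700 * Nat.choose 41 35) * 2 ^ 33) (Nat.choose 41 35) 89
        (by norm_num) (by norm_num) (by norm_num) key_six_sub_35_89'
      intro n hn
      have := hk n hn
      simpa using this
    · refine core_six_corank_of_key_sub' 89 le_rfl M 36 (by norm_num) ?_ (by omega) hfree
      have hk := key_of_base' 36 6 ((2 ^ 42 + 7700 * Nat.choose 42 36) * 2 ^ 33) (Nat.choose 42 36) 89
        (by norm_num) (by norm_num) (by norm_num) key_six_sub_36_89'
      intro n hn
      have := hk n hn
      simpa using this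

end ThmN

end PercRepro
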